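import Literature.NumberTheory.Automorphic.ResGLnHermitianConeGauge
import Literature.NumberTheory.Automorphic.TwistedQuotientPullbackCalculus
import HarnessLib

/-!
# Transfer of polynomial `C¹` bounds along an equivariance; entry-gauge bookkeeping on the
# hermitian cone of `Res_{K/ℚ} GL_n`

Topic `NumberTheory/Automorphic`; namespace `Literature.NumberTheory.Automorphic`, grouping
sub-namespace `ConeGlobalGrowth`.  Theorems only (no definition, no named fact).  This is the
elementary half of the step "growth on reduced sets ⟹ growth on the whole cone" in Borel's
regularisation of equivariant forms [Borel1983Regularization, §3.5], made abstract and reusable: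

* `transfer`, `transfer_bound` — a group `Γ` acts on a real normed space `W` by
  `a : Γ →* (W →L[ℝ] W)` preserving an open `X`, on cosets `𝒢 ⧸ L` through `ι : Γ →* 𝒢`, on the
  coefficients `V` through `ρ`; a family `β c` of `q`-forms is EQUIVARIANT:
  `β (ι γ • c) (γ·x) (γ·v) = ρ γ (β c x v)`.  If `ι g • c' = c`, then `β c` at `x` is the twisted
  pull-back of `β c'` at `g⁻¹ · x` — the value AND the derivative (both sides agree on a neighbourhood,
  chain rule through the fixed linear maps, `TwistedQuotient.fderiv_actAlt_comp_apply`) — whence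
  `‖β c x v‖ ≤ A R B^q ∏ ‖vᵢ‖`, `‖D(β c)(x) w v‖ ≤ A R B^{q+1} ‖w‖ ∏ ‖vᵢ‖` from `‖ρ g‖ ≤ A`,
  `‖a g⁻¹‖ ≤ B` and a bound `R` for `β c'` at `g⁻¹ · x`;
* `arith`, `numeric`, `single_le_sum₂`, `gauge_le_of_entry_le`, `le_one_add_sum_of_mem` — the real
  bookkeeping collecting all sizes into one base `u = (1 + n²) D² e^{2k+1}`;
* on the cone (`ResGLnHermitianCone`): `norm_entry_le_and_le_sum` (sup norm against entries),
  `norm_coneActionRat_le` (`‖A · x‖ ≤ n² (∑ ‖θ(A)_ij‖)² ‖x‖`), `gauge_translate_le`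
  (`E(A⁻¹ · H) ≤ (1 + ∑ ‖θ(A)_ij‖ + ∑ ‖θ(A⁻¹)_ij‖)² E(H)` for the entry gauge
  `E(H) = 1 + ∑ (‖H_ij‖ + ‖H⁻¹_ij‖)`), `entry_mul_le` (entries of a rational product at the
  archimedean places).

Not here: reduction theory, the reducing-element bound, coefficient growth (problem-side files).

## References

* A. Borel, *Regularization theorems in Lie algebra cohomology. Applications*, Duke Math. J. 50
  (1983), §3.5. [Borel1983Regularization]
* A. Borel, N. Wallach, *Continuous cohomology, discrete subgroups, and representations of reductive
  groups*, 2nd ed. (2000), VII 2.2. [BorelWallach2000]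
* A. Borel, *Introduction aux groupes arithmétiques*, Hermann (1969), §12. [Borel1969]
-/

noncomputable section

open Set Filter NumberField NumberField.mixedEmbedding
open scoped Topology Matrix Classical

namespace Literature.NumberTheory.Automorphic

namespace ConeGlobalGrowth

open TwistedQuotient

/-! ### Generic layer: moving a point by the equivariance -/

section Generic

variable {Γ 𝒢 : Type} [Group Γ] [Group 𝒢] (ι : Γ →* 𝒢) (L : Subgroup 𝒢)
  {V : Type} [NormedAddCommGroup V] [NormedSpace ℂ V] [FiniteDimensional ℂ V] (ρ : Representation ℂ Γ V)
  {W : Type} [NormedAddCommGroup W] [NormedSpace ℝ W] (a : Γ →* (W →L[ℝ] W))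

/-- **Transfer by the equivariance.**  If `ι g • c' = c`, then on the `Γ`-stable open `X` the form
`β c` is the twisted pull-back of `β c'` by `g⁻¹`: `β c x v = ρ g (β c' (g⁻¹x) (g⁻¹v))`, and the same
for the derivative (both sides agree on a neighbourhood of `x`; chain rule through the fixed continuous
linear maps). [cite: BorelWallach2000, VII 2.2] -/
theorem transfer {X : Set W} (hXo : IsOpen X) (hmaps : ∀ γ : Γ, MapsTo (a γ) X X) {q : ℕ}
    (β : 𝒢 ⧸ L → W → W [⋀^Fin q]→L[ℝ] V)
    (hs : ∀ c, ContDiffOn ℝ ((⊤ : ℕ∞) : WithTop ℕ∞) (β c) X)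
    (he : ∀ (γ : Γ) (c : 𝒢 ⧸ L), ∀ x ∈ X, ∀ v : Fin q → W,
      β (ι γ • c) (a γ x) (fun i => a γ (v i)) = ρ γ (β c x v))
    (g : Γ) {c c' : 𝒢 ⧸ L} (hc : ι g • c' = c) {x : W} (hx : x ∈ X) (v : Fin q → W) (w' : W) :
    β c x v = ρ g (β c' (a g⁻¹ x) fun i => a g⁻¹ (v i)) ∧
      fderiv ℝ (β c) x w' v =
        ρ g (fderiv ℝ (β c') (a g⁻¹ x) (a g⁻¹ w') fun i => a g⁻¹ (v i)) := by
  -- the pointwise identity on `X`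
  have hpt : ∀ y ∈ X, β c y = actAlt ρ a g q (β c' (a g⁻¹ y)) := by
    intro y hy
    ext u
    rw [actAlt_apply]
    have key := he g c' (a g⁻¹ y) (hmaps _ hy) fun i => a g⁻¹ (u i)
    simp only [act_apply_inv, hc] at key
    exact key
  refine ⟨by rw [hpt x hx, actAlt_apply], ?_⟩
  -- the derivative: `β c` agrees with the twisted pull-back near `x`; chain rule through the fixed
  -- linear maps (`fderiv_actAlt_comp_apply`)
  have hdiff : DifferentiableAt ℝ (β c') (a g⁻¹ x) :=
    ((hs c').contDiffAt (hXo.mem_nhds (hmaps _ hx))).differentiableAt (by simp)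
  have hev : β c =ᶠ[𝓝 x] fun y => actAlt ρ a g q (β c' (a g⁻¹ y)) :=
    Filter.eventuallyEq_of_mem (hXo.mem_nhds hx) fun y hy' => hpt y hy'
  rw [hev.fderiv_eq, fderiv_actAlt_comp_apply ρ a g hdiff w', actAlt_apply]

/-- **Bounds after the transfer**: with `‖ρ g‖ ≤ A`, `‖a g⁻¹‖ ≤ B` and the bound `R` for `β c'` and
its derivative at `g⁻¹ · x`, `‖β c x v‖ ≤ A R B^q ∏ ‖vᵢ‖` and
`‖D(β c)(x) w' v‖ ≤ A R B^{q+1} ‖w'‖ ∏ ‖vᵢ‖`. [folklore] -/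
theorem transfer_bound {X : Set W} (hXo : IsOpen X) (hmaps : ∀ γ : Γ, MapsTo (a γ) X X) {q : ℕ}
    (β : 𝒢 ⧸ L → W → W [⋀^Fin q]→L[ℝ] V)
    (hs : ∀ c, ContDiffOn ℝ ((⊤ : ℕ∞) : WithTop ℕ∞) (β c) X)
    (he : ∀ (γ : Γ) (c : 𝒢 ⧸ L), ∀ x ∈ X, ∀ v : Fin q → W,
      β (ι γ • c) (a γ x) (fun i => a γ (v i)) = ρ γ (β c x v))
    (g : Γ) {c c' : 𝒢 ⧸ L} (hc : ι g • c' = c) {x : W} (hx : x ∈ X)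
    {A B R : ℝ} (hA0 : 0 ≤ A) (hA : ∀ Y : V, ‖ρ g Y‖ ≤ A * ‖Y‖) (hB0 : 0 ≤ B)
    (hB : ∀ y : W, ‖a g⁻¹ y‖ ≤ B * ‖y‖) (hR0 : 0 ≤ R)
    (hR : ∀ (v : Fin q → W) (w' : W), ‖β c' (a g⁻¹ x) v‖ ≤ R * ∏ i, ‖v i‖ ∧
      ‖fderiv ℝ (β c') (a g⁻¹ x) w' v‖ ≤ R * ‖w'‖ * ∏ i, ‖v i‖)
    (v : Fin q → W) (w' : W) :
    ‖β c x v‖ ≤ A * R * B ^ q * ∏ i, ‖v i‖ ∧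
      ‖fderiv ℝ (β c) x w' v‖ ≤ A * R * B ^ (q + 1) * ‖w'‖ * ∏ i, ‖v i‖ := by
  obtain ⟨h1, h2⟩ := transfer ι L ρ a hXo hmaps β hs he g hc hx v w'
  have hPa : ∏ i, ‖a g⁻¹ (v i)‖ ≤ B ^ q * ∏ i, ‖v i‖ := by
    calc ∏ i, ‖a g⁻¹ (v i)‖ ≤ ∏ i, B * ‖v i‖ :=
          Finset.prod_le_prod (fun i _ => norm_nonneg _) fun i _ => hB (v i)
      _ = B ^ q * ∏ i, ‖v i‖ := by
          rw [Finset.prod_mul_distrib, Finset.prod_const, Finset.card_univ, Fintype.card_fin]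
  have hPa0 : 0 ≤ ∏ i, ‖a g⁻¹ (v i)‖ := Finset.prod_nonneg fun i _ => norm_nonneg _
  constructor
  · rw [h1]
    calc ‖ρ g (β c' (a g⁻¹ x) fun i => a g⁻¹ (v i))‖
        ≤ A * ‖β c' (a g⁻¹ x) fun i => a g⁻¹ (v i)‖ := hA _
      _ ≤ A * (R * ∏ i, ‖a g⁻¹ (v i)‖) := mul_le_mul_of_nonneg_left (hR _ w').1 hA0
      _ ≤ A * (R * (B ^ q * ∏ i, ‖v i‖)) :=
          mul_le_mul_of_nonneg_left (mul_le_mul_of_nonneg_left hPa hR0) hA0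
      _ = A * R * B ^ q * ∏ i, ‖v i‖ := by ring
  · rw [h2]
    calc ‖ρ g (fderiv ℝ (β c') (a g⁻¹ x) (a g⁻¹ w') fun i => a g⁻¹ (v i))‖
        ≤ A * ‖fderiv ℝ (β c') (a g⁻¹ x) (a g⁻¹ w') fun i => a g⁻¹ (v i)‖ := hA _
      _ ≤ A * (R * ‖a g⁻¹ w'‖ * ∏ i, ‖a g⁻¹ (v i)‖) := mul_le_mul_of_nonneg_left (hR _ _).2 hA0
      _ ≤ A * (R * (B * ‖w'‖) * (B ^ q * ∏ i, ‖v i‖)) := by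
          refine mul_le_mul_of_nonneg_left (mul_le_mul (mul_le_mul_of_nonneg_left (hB w') hR0) hPa hPa0
            (mul_nonneg hR0 (mul_nonneg hB0 (norm_nonneg _)))) hA0
      _ = A * R * B ^ (q + 1) * ‖w'‖ * ∏ i, ‖v i‖ := by ring

end Generic

/-! ### Bookkeeping of real constants -/

/-- Single terms are bounded by a double sum of non-negative terms. [folklore] -/
theorem single_le_sum₂ {n : ℕ} {f g : Fin n → Fin n → ℝ} (hf : ∀ i j, 0 ≤ f i j)
    (hg : ∀ i j, 0 ≤ g i j) (i j : Fin n) :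
    f i j ≤ ∑ i, ∑ j, (f i j + g i j) ∧ g i j ≤ ∑ i, ∑ j, (f i j + g i j) := by
  have h : f i j + g i j ≤ ∑ i, ∑ j, (f i j + g i j) :=
    (Finset.single_le_sum (f := fun j => f i j + g i j) (fun j _ => add_nonneg (hf i j) (hg i j))
      (Finset.mem_univ j)).trans
      (Finset.single_le_sum (f := fun i => ∑ j, (f i j + g i j))
        (fun i _ => Finset.sum_nonneg fun j _ => add_nonneg (hf i j) (hg i j)) (Finset.mem_univ i))
  exact ⟨(le_add_of_nonneg_right (hg i j)).trans h, (le_add_of_nonneg_left (hf i j)).trans h⟩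

/-- A double sum of `2 n²` terms bounded by `b` is at most `2 n² b`. [folklore] -/
theorem gauge_le_of_entry_le {n : ℕ} {f g : Fin n → Fin n → ℝ} {b : ℝ} (hf : ∀ i j, f i j ≤ b)
    (hg : ∀ i j, g i j ≤ b) : 1 + ∑ i, ∑ j, (f i j + g i j) ≤ 1 + 2 * (n : ℝ) ^ 2 * b := by
  have h : ∑ i, ∑ j, (f i j + g i j) ≤ ∑ _i : Fin n, ∑ _j : Fin n, (b + b) :=
    Finset.sum_le_sum fun i _ => Finset.sum_le_sum fun j _ => add_le_add (hf i j) (hg i j)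
  simp only [Finset.sum_const, Finset.card_univ, Fintype.card_fin, nsmul_eq_mul] at h
  have h2 : (n : ℝ) * (n * (b + b)) = 2 * (n : ℝ) ^ 2 * b := by ring
  linarith [h, h2]

/-- For `t` in the finite set `T` and non-negative `f, g`:
`f t i j, g t i j ≤ 1 + ∑_{t ∈ T} ∑_{i,j} (f t i j + g t i j)`. [folklore] -/
theorem le_one_add_sum_of_mem {n : ℕ} {α : Type*} {T : Finset α} {f g : α → Fin n → Fin n → ℝ}
    (hf : ∀ t i j, 0 ≤ f t i j) (hg : ∀ t i j, 0 ≤ g t i j) {t : α} (ht : t ∈ T) (i j : Fin n) :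
    f t i j ≤ 1 + ∑ t ∈ T, ∑ i, ∑ j, (f t i j + g t i j) ∧
      g t i j ≤ 1 + ∑ t ∈ T, ∑ i, ∑ j, (f t i j + g t i j) := by
  have hsum : ∑ i, ∑ j, (f t i j + g t i j) ≤ 1 + ∑ t ∈ T, ∑ i, ∑ j, (f t i j + g t i j) :=
    (Finset.single_le_sum (f := fun t => ∑ i, ∑ j, (f t i j + g t i j))
      (fun t _ => Finset.sum_nonneg fun i _ => Finset.sum_nonneg fun j _ => add_nonneg (hf t i j) (hg t i j))
      ht).trans (le_add_of_nonneg_left zero_le_one)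
  exact ⟨((single_le_sum₂ (hf t) (hg t) i j).1).trans hsum,
    ((single_le_sum₂ (hf t) (hg t) i j).2).trans hsum⟩

/-- The final bookkeeping: `A ≤ Cσ u^{kσ}`, `R ≤ Cb u^{kb}`, `1 ≤ B ≤ u` give
`A R B^q ≤ Cσ Cb u^{kσ + kb + q + 1}` and the same with `B^{q+1}`. [folklore] -/
theorem arith {A R B u Cσ Cb Wn P : ℝ} {kσ kb q : ℕ} (hu : 1 ≤ u) (hA0 : 0 ≤ A) (hA : A ≤ Cσ * u ^ kσ)
    (hR0 : 0 ≤ R) (hR : R ≤ Cb * u ^ kb) (hB1 : 1 ≤ B) (hB : B ≤ u) (hWn : 0 ≤ Wn) (hP : 0 ≤ P) :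
    A * R * B ^ q * P ≤ Cσ * Cb * u ^ (kσ + kb + q + 1) * P ∧
      A * R * B ^ (q + 1) * Wn * P ≤ Cσ * Cb * u ^ (kσ + kb + q + 1) * Wn * P := by
  have hB0 : 0 ≤ B := zero_le_one.trans hB1
  have hBq : B ^ q ≤ u ^ (q + 1) :=
    (pow_le_pow_left₀ hB0 hB q).trans (pow_le_pow_right₀ hu (Nat.le_succ q))
  have hBq1 : B ^ (q + 1) ≤ u ^ (q + 1) := pow_le_pow_left₀ hB0 hB (q + 1)
  have key : ∀ X : ℝ, 0 ≤ X → X ≤ u ^ (q + 1) → A * R * X ≤ Cσ * Cb * u ^ (kσ + kb + q + 1) := by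
    intro X hX0 hX
    have hAR : A * R ≤ Cσ * u ^ kσ * (Cb * u ^ kb) := mul_le_mul hA hR hR0 (hA0.trans hA)
    calc A * R * X ≤ Cσ * u ^ kσ * (Cb * u ^ kb) * u ^ (q + 1) :=
          mul_le_mul hAR hX hX0 ((mul_nonneg hA0 hR0).trans hAR)
      _ = Cσ * Cb * u ^ (kσ + kb + q + 1) := by ring
  exact ⟨mul_le_mul_of_nonneg_right (key _ (pow_nonneg hB0 q) hBq) hP,
    mul_le_mul_of_nonneg_right (mul_le_mul_of_nonneg_right (key _ (pow_nonneg hB0 _) hBq1) hWn) hP⟩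

/-- `1 + b² + a² ≤ (1 + a + b)²` for `a, b ≥ 0`. [folklore] -/
theorem sq_helper {a b : ℝ} (ha : 0 ≤ a) (hb : 0 ≤ b) : 1 + b ^ 2 + a ^ 2 ≤ (1 + a + b) ^ 2 := by
  nlinarith [mul_nonneg ha hb]

/-- **The numeric core**: with `s ≤ 1 + 2n²·n R₁ e^{k} B_T`, `E(M) ≤ s² e`, all sizes are bounded by
the single base `u = (1 + n²)(1 + 2 n³ R₁ B_T)² e^{2k+1} ≥ 1`. [folklore] -/
theorem numeric {s S' EM e R₁ Bt D N u : ℝ} {n kR : ℕ}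
    (hR₁ : 1 ≤ R₁) (hBt : 0 ≤ Bt) (he1 : 1 ≤ e) (hS' : 0 ≤ S') (hS's : S' ≤ s) (hs1 : 1 ≤ s)
    (hsle : s ≤ 1 + 2 * (n : ℝ) ^ 2 * (n * (R₁ * e ^ kR * Bt)))
    (hEM : EM ≤ s ^ 2 * e)
    (hD : D = 1 + 2 * (n : ℝ) ^ 3 * R₁ * Bt) (hN : N = 1 + (n : ℝ) ^ 2)
    (hu : u = N * D ^ 2 * e ^ (2 * kR + 1)) :
    1 ≤ u ∧ s ≤ u ∧ EM ≤ u ∧ 1 + (n : ℝ) ^ 2 * S' ^ 2 ≤ u := by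
  have he0 : 0 ≤ e := zero_le_one.trans he1
  have hekR : 1 ≤ e ^ kR := one_le_pow₀ he1
  have hR₁0 : 0 ≤ R₁ := zero_le_one.trans hR₁
  have hs0 : 0 ≤ s := zero_le_one.trans hs1
  have hD1 : 1 ≤ D := by
    rw [hD]
    exact le_add_of_nonneg_right (by positivity)
  have hN1 : 1 ≤ N := by
    rw [hN]
    exact le_add_of_nonneg_right (by positivity)
  have hN0 : 0 ≤ N := zero_le_one.trans hN1
  have hsD : s ≤ D * e ^ kR := by
    calc s ≤ 1 + 2 * (n : ℝ) ^ 2 * (n * (R₁ * e ^ kR * Bt)) := hsle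
      _ = 1 + (2 * (n : ℝ) ^ 3 * R₁ * Bt) * e ^ kR := by ring
      _ ≤ 1 * e ^ kR + (2 * (n : ℝ) ^ 3 * R₁ * Bt) * e ^ kR := by
          rw [one_mul]
          exact add_le_add hekR le_rfl
      _ = D * e ^ kR := by rw [hD]; ring
  have hsq : s ^ 2 * e ≤ D ^ 2 * e ^ (2 * kR + 1) := by
    have h1 : s ^ 2 ≤ (D * e ^ kR) ^ 2 := pow_le_pow_left₀ hs0 hsD 2
    calc s ^ 2 * e ≤ (D * e ^ kR) ^ 2 * e := mul_le_mul_of_nonneg_right h1 he0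
      _ = D ^ 2 * e ^ (2 * kR + 1) := by ring
  have hD2e : D ^ 2 * e ^ (2 * kR + 1) ≤ u := by
    rw [hu, mul_assoc]
    exact le_mul_of_one_le_left (by positivity) hN1
  have hu1 : 1 ≤ u := (one_le_mul_of_one_le_of_one_le (one_le_pow₀ hD1) (one_le_pow₀ he1)).trans hD2e
  have hs2 : s ≤ s ^ 2 * e := by
    calc s = s * 1 * 1 := by ring
      _ ≤ s * s * e := mul_le_mul (mul_le_mul_of_nonneg_left hs1 hs0) he1 zero_le_one (mul_nonneg hs0 hs0)
      _ = s ^ 2 * e := by ring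
  refine ⟨hu1, hs2.trans (hsq.trans hD2e), hEM.trans (hsq.trans hD2e), ?_⟩
  have h1 : 1 + (n : ℝ) ^ 2 * S' ^ 2 ≤ N * s ^ 2 := by
    rw [hN, add_mul, one_mul]
    have h3 : S' ^ 2 ≤ s ^ 2 := pow_le_pow_left₀ hS' hS's 2
    have h4 : (1 : ℝ) ≤ s ^ 2 := one_le_pow₀ hs1
    exact add_le_add h4 (mul_le_mul_of_nonneg_left h3 (sq_nonneg _))
  calc 1 + (n : ℝ) ^ 2 * S' ^ 2 ≤ N * s ^ 2 := h1
    _ ≤ N * (s ^ 2 * e) := mul_le_mul_of_nonneg_left (le_mul_of_one_le_right (sq_nonneg _) he1) hN0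
    _ ≤ N * (D ^ 2 * e ^ (2 * kR + 1)) := mul_le_mul_of_nonneg_left hsq hN0
    _ = u := by rw [hu]; ring

/-! ### On the hermitian cone: entries, the cone action, the entry gauge of a translate -/

section Cone

open ResGLnCone

variable {n : ℕ} {K : Type} [Field K] [NumberField K]

/-- The entries of a hermitian matrix are bounded by its (sup) norm, and the norm by the entry sum.
[folklore] -/
theorem norm_entry_le_and_le_sum (x : hermSpace n K) :
    (∀ i j, ‖x.1 i j‖ ≤ ‖x‖) ∧ ‖x‖ ≤ ∑ i, ∑ j, ‖x.1 i j‖ := by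
  have h : ‖x‖ = ‖(show Fin n → Fin n → mixedSpace K from x.1)‖ := rfl
  rw [h]
  refine ⟨fun i j => (norm_le_pi_norm ((show Fin n → Fin n → mixedSpace K from x.1) i) j).trans
    (norm_le_pi_norm (show Fin n → Fin n → mixedSpace K from x.1) i), ?_⟩
  have h0 : 0 ≤ ∑ i, ∑ j, ‖x.1 i j‖ :=
    Finset.sum_nonneg fun _ _ => Finset.sum_nonneg fun _ _ => norm_nonneg _
  refine (pi_norm_le_iff_of_nonneg h0).2 fun i => (pi_norm_le_iff_of_nonneg h0).2 fun j => ?_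
  exact (Finset.single_le_sum (f := fun j => ‖x.1 i j‖) (fun _ _ => norm_nonneg _) (Finset.mem_univ j)).trans
    (Finset.single_le_sum (f := fun i' => ∑ j, ‖x.1 i' j‖)
      (fun _ _ => Finset.sum_nonneg fun _ _ => norm_nonneg _) (Finset.mem_univ i))

/-- **The cone action is bounded by the entry sum**: `‖A · x‖ ≤ n² (∑ ‖θ(A)_ij‖)² ‖x‖`. [folklore] -/
theorem norm_coneActionRat_le (A : GL (Fin n) K) (x : hermSpace n K) :
    ‖coneActionRat n K A x‖ ≤ (n : ℝ) ^ 2 * (∑ i, ∑ j, ‖(toMixedGL n K A).1 i j‖) ^ 2 * ‖x‖ := by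
  have hval : (coneActionRat n K A x).1 = (toMixedGL n K A).1 * x.1 * (toMixedGL n K A).1ᴴ := by
    rw [coneActionRat_apply, coe_coneAction]
  have hS0 : 0 ≤ ∑ i, ∑ j, ‖(toMixedGL n K A).1 i j‖ :=
    Finset.sum_nonneg fun _ _ => Finset.sum_nonneg fun _ _ => norm_nonneg _
  have hx : ∑ i, ∑ j, ‖x.1 i j‖ ≤ (n : ℝ) ^ 2 * ‖x‖ := by
    calc ∑ i, ∑ j, ‖x.1 i j‖ ≤ ∑ _i : Fin n, ∑ _j : Fin n, ‖x‖ :=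
          Finset.sum_le_sum fun i _ => Finset.sum_le_sum fun j _ => (norm_entry_le_and_le_sum x).1 i j
      _ = (n : ℝ) ^ 2 * ‖x‖ := by
          simp only [Finset.sum_const, Finset.card_univ, Fintype.card_fin, nsmul_eq_mul]
          ring
  calc ‖coneActionRat n K A x‖
      ≤ ∑ i, ∑ j, ‖(coneActionRat n K A x).1 i j‖ := (norm_entry_le_and_le_sum _).2
    _ = ∑ i, ∑ j, ‖((toMixedGL n K A).1 * x.1 * (toMixedGL n K A).1ᴴ) i j‖ := by rw [hval]
    _ ≤ (∑ i, ∑ j, ‖((toMixedGL n K A).1 * x.1) i j‖) * ∑ i, ∑ j, ‖(toMixedGL n K A).1ᴴ i j‖ :=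
        sum_norm_mul_apply_le _ _
    _ ≤ ((∑ i, ∑ j, ‖(toMixedGL n K A).1 i j‖) * ∑ i, ∑ j, ‖x.1 i j‖) *
          ∑ i, ∑ j, ‖(toMixedGL n K A).1 i j‖ := by
        rw [sum_norm_conjTranspose_apply]
        exact mul_le_mul_of_nonneg_right (sum_norm_mul_apply_le _ _) hS0
    _ ≤ ((∑ i, ∑ j, ‖(toMixedGL n K A).1 i j‖) * ((n : ℝ) ^ 2 * ‖x‖)) *
          ∑ i, ∑ j, ‖(toMixedGL n K A).1 i j‖ :=
        mul_le_mul_of_nonneg_right (mul_le_mul_of_nonneg_left hx hS0) hS0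
    _ = (n : ℝ) ^ 2 * (∑ i, ∑ j, ‖(toMixedGL n K A).1 i j‖) ^ 2 * ‖x‖ := by ring

/-- **The gauge of a translate**: `E(A⁻¹ · H) ≤ (1 + ∑ ‖θ(A)_ij‖ + ∑ ‖θ(A⁻¹)_ij‖)² E(H)`
(`entryGauge_conj_le`). [cite: Borel1969, §12] -/
theorem gauge_translate_le (A : GL (Fin n) K) (H : hermSpace n K) :
    (1 + ∑ i, ∑ j, (‖(coneActionRat n K A⁻¹ H).1 i j‖ + ‖(coneActionRat n K A⁻¹ H).1⁻¹ i j‖)) ≤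
      (1 + ∑ i, ∑ j, (‖(toMixedGL n K A).1 i j‖ + ‖(toMixedGL n K A⁻¹).1 i j‖)) ^ 2 *
        (1 + ∑ i, ∑ j, (‖H.1 i j‖ + ‖H.1⁻¹ i j‖)) := by
  have hinv : (toMixedGL n K A⁻¹).1⁻¹ = (toMixedGL n K A).1 := by
    rw [← Matrix.coe_units_inv, ← map_inv, inv_inv]
  have h := entryGauge_conj_le (toMixedGL n K A⁻¹).1 H.1
  rw [hinv] at h
  have hval : (coneActionRat n K A⁻¹ H).1 = (toMixedGL n K A⁻¹).1 * H.1 * (toMixedGL n K A⁻¹).1ᴴ := by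
    rw [coneActionRat_apply, coe_coneAction]
  rw [hval]
  simp only [Finset.sum_add_distrib, ← add_assoc] at h ⊢
  have hS : 0 ≤ ∑ i, ∑ j, ‖(toMixedGL n K A).1 i j‖ :=
    Finset.sum_nonneg fun _ _ => Finset.sum_nonneg fun _ _ => norm_nonneg _
  have hS' : 0 ≤ ∑ i, ∑ j, ‖(toMixedGL n K A⁻¹).1 i j‖ :=
    Finset.sum_nonneg fun _ _ => Finset.sum_nonneg fun _ _ => norm_nonneg _
  have hE : 0 ≤ 1 + ∑ i, ∑ j, ‖H.1 i j‖ + ∑ i, ∑ j, ‖H.1⁻¹ i j‖ :=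
    add_nonneg (add_nonneg zero_le_one (Finset.sum_nonneg fun _ _ => Finset.sum_nonneg fun _ _ => norm_nonneg _))
      (Finset.sum_nonneg fun _ _ => Finset.sum_nonneg fun _ _ => norm_nonneg _)
  exact h.trans (mul_le_mul_of_nonneg_right (sq_helper hS hS') hE)

/-- Entries of a product `P Q` at the archimedean places: `‖(PQ)_ij‖ ≤ n p r` if `‖P_il‖ ≤ p`,
`‖Q_lj‖ ≤ r`. [folklore] -/
theorem entry_mul_le {P Q : Matrix (Fin n) (Fin n) K} {p r : ℝ} (hp : 0 ≤ p)
    (hP : ∀ i j, ‖mixedEmbedding K (P i j)‖ ≤ p) (hQ : ∀ i j, ‖mixedEmbedding K (Q i j)‖ ≤ r)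
    (i j : Fin n) :
    ‖mixedEmbedding K ((P * Q) i j)‖ ≤ n * (p * r) := by
  rw [Matrix.mul_apply, map_sum]
  refine (norm_sum_le _ _).trans ?_
  calc ∑ l, ‖mixedEmbedding K (P i l * Q l j)‖ ≤ ∑ _l : Fin n, p * r := Finset.sum_le_sum fun l _ => by
        rw [map_mul]
        exact (norm_mul_le _ _).trans (mul_le_mul (hP i l) (hQ l j) (norm_nonneg _) hp)
    _ = n * (p * r) := by rw [Finset.sum_const, Finset.card_univ, Fintype.card_fin, nsmul_eq_mul]

end Cone

end ConeGlobalGrowth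

end Literature.NumberTheory.Automorphic

end
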